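import Mathlib
import HarnessLib
import Literature.Combinatorics.Additive.Pollard
import Literature.Combinatorics.Additive.Kneser
import Literature.Combinatorics.Additive.GrynkiewiczPollardRep
import Literature.Combinatorics.Additive.GrynkiewiczPollardKneserTools
import Literature.Combinatorics.Additive.GrynkiewiczPollardStepOne

/-!
# Grynkiewicz's extension of Pollard's theorem — port, part IV: the induction measure and STEP 2

Topic: `Literature/Combinatorics/Additive`.  Fourth file of the port of [Gry10] Theorem 1.1 / 1.2.

* `Grynkiewicz.meas t A B` — the lexicographic induction measure `(N_t(A,B), 2N_t − |A| − |B|, min(|A|,|B|))`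
  of the triple induction in [Gry10] §2, and `Grynkiewicz.IH t c A B` — "`Goal` holds for every pair of
  smaller measure with both sets of size `≥ t`";
* **STEP 2**: if erasing some `y ∈ B` (or `y ∈ A`) lowers `N_t` by at least `t`, the induction hypothesis
  for `(A, B ∖ {y})` and STEP 1 give `Goal t c A B` (for `t² ≤ c`);
* its corollaries used throughout §2: a row/column with `≥ t` sums of `≤ t` representations, the
  pigeonhole form (unstuff), and `|stab(A)| ≥ t ⇒ Goal` ((stab-A-small)).

## References
* D. J. Grynkiewicz, *On extending Pollard's theorem for t-representable sums*, Israel J. Math. 177 (2010)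
  413–439 (arXiv:0803.2601), §2 Step 2 [cite: Grynkiewicz2010, Thm 1.1].
-/

namespace Literature.Combinatorics.Additive

namespace Grynkiewicz

open Finset Pollard
open scoped Pointwise

variable {G : Type*} [AddCommGroup G] [DecidableEq G]

/-! ### The induction measure -/

/-- The lexicographic measure of [Gry10]'s triple induction:
`(N_t(A,B), 2 N_t(A,B) − (|A| + |B|), min(|A|, |B|))`. [cite: Grynkiewicz2010, §2] -/
def meas (t : ℕ) (A B : Finset G) : ℕ ×ₗ ℕ ×ₗ ℕ :=
  toLex (NS t A B, toLex (2 * NS t A B - (A.card + B.card), min A.card B.card))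

/-- The induction hypothesis at `(A,B)`: `Goal` for all pairs of smaller measure with `|A₁|, |B₁| ≥ t`.
[cite: Grynkiewicz2010, §2] -/
def IH (t c : ℕ) (A B : Finset G) : Prop :=
  ∀ A₁ B₁ : Finset G, meas t A₁ B₁ < meas t A B → t ≤ A₁.card → t ≤ B₁.card → Goal t c A₁ B₁

section Meas

variable {t c : ℕ} {A B A₁ B₁ : Finset G}

/-- The measure is symmetric. [cite: Grynkiewicz2010, §2] -/
theorem meas_comm (t : ℕ) (A B : Finset G) : meas t A B = meas t B A := by
  unfold meas; rw [NS_comm, add_comm A.card, min_comm]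

/-- First induction level: smaller `N_t`. [cite: Grynkiewicz2010, §2] -/
theorem meas_lt_of_NS_lt (h : NS t A₁ B₁ < NS t A B) : meas t A₁ B₁ < meas t A B := by
  unfold meas; rw [Prod.Lex.lt_iff]; exact Or.inl h

/-- Second induction level: same `N_t`, larger `|A| + |B|` (when `|A| + |B| < 2 N_t`). [cite: Grynkiewicz2010, §2] -/
theorem meas_lt_of_card_lt (h : NS t A₁ B₁ = NS t A B) (h2 : A.card + B.card < A₁.card + B₁.card)
    (h3 : A₁.card + B₁.card ≤ 2 * NS t A B) : meas t A₁ B₁ < meas t A B := by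
  unfold meas
  rw [Prod.Lex.lt_iff]
  refine Or.inr ⟨h, ?_⟩
  rw [Prod.Lex.lt_iff]
  left
  rw [h]
  show 2 * NS t A B - (A₁.card + B₁.card) < 2 * NS t A B - (A.card + B.card)
  omega

/-- Third induction level: same `N_t`, same `|A| + |B|`, smaller `min(|A|,|B|)`. [cite: Grynkiewicz2010, §2] -/
theorem meas_lt_of_min_lt (h : NS t A₁ B₁ = NS t A B) (h2 : A₁.card + B₁.card = A.card + B.card)
    (h3 : min A₁.card B₁.card < min A.card B.card) : meas t A₁ B₁ < meas t A B := by
  unfold meas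
  rw [Prod.Lex.lt_iff]
  refine Or.inr ⟨h, ?_⟩
  rw [Prod.Lex.lt_iff]
  right
  rw [h, h2]
  exact ⟨rfl, h3⟩

/-- A pair of measure at most that of `(A,B)`'s... : `N_t` not larger and everything else fine — the
convenient "`N_t` strictly smaller or else" entry point. [cite: Grynkiewicz2010, §2] -/
theorem IH.symm (h : IH t c A B) : IH t c B A := fun A₁ B₁ hlt h1 h2 => by
  rw [← meas_comm t A B] at hlt; exact h A₁ B₁ hlt h1 h2

/-- `IH` applied through a symmetric conclusion. [cite: Grynkiewicz2010, §2] -/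
theorem IH.apply_symm (h : IH t c A B) (hlt : meas t A₁ B₁ < meas t A B) (h1 : t ≤ A₁.card)
    (h2 : t ≤ B₁.card) : Goal t c B₁ A₁ :=
  (h A₁ B₁ hlt h1 h2).symm

/-- For `t ≥ 2` and `|A|, |B| ≥ t`: `|A| + |B| < 2 N_t(A,B)` (so the second measure component is a true
difference). [cite: Grynkiewicz2010, §2] -/
theorem card_add_card_lt_two_mul_NS (ht : 2 ≤ t) (hA : t ≤ A.card) (hB : t ≤ B.card) :
    A.card + B.card < 2 * NS t A B := by
  have h1 := mul_card_le_NS A hB (t := t)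
  have h2 := mul_card_le_NS_left hA B (t := t)
  nlinarith

end Meas

/-! ### STEP 2 -/

section StepTwo

variable {t c : ℕ} {A B : Finset G}

/-- **STEP 2 of [Gry10] §2** (erasing from `B`).  Let `t ≥ 1`, `t² ≤ c`, `|A|, |B| ≥ t + 1`, and assume
the induction hypothesis below `(A,B)`.  If for some `y ∈ B` one has `N_t(A, B ∖ {y}) ≤ N_t(A,B) − t`,
then `Goal t c A B`. [cite: Grynkiewicz2010, §2 Step 2] -/
theorem step_two (ht : 1 ≤ t) (hc : t * t ≤ c) (ih : IH t c A B) (hA : t + 1 ≤ A.card)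
    (hB : t + 1 ≤ B.card) {y : G} (hy : y ∈ B) (hdrop : NS t A (B.erase y) + t ≤ NS t A B) :
    Goal t c A B := by
  have hBe : (B.erase y).card + 1 = B.card := by rw [card_erase_of_mem hy]; omega
  have hBt : t ≤ (B.erase y).card := by omega
  have hlt : meas t A (B.erase y) < meas t A B := meas_lt_of_NS_lt (by omega)
  have e0 : t * (A.card + B.card) = t * (A.card + (B.erase y).card) + t := by rw [← hBe]; ring
  rcases ih A (B.erase y) hlt (by omega) hBt with hP | ⟨A', B', hS⟩
  · left; rw [e0]; omega
  -- structural case for `(A, B ∖ {y})`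
  obtain ⟨hA'ne, hB'ne⟩ := hS.nonempty (by omega) hBt
  obtain ⟨A'', B'', hS2, hsum, hsubA, hsubB, hsA, hsB⟩ := hS.saturate hA'ne hB'ne
  rw [← hsum] at hsA hsB
  have hA''ne : A''.Nonempty := hA'ne.mono hsubA
  have hB''ne : B''.Nonempty := hB'ne.mono hsubB
  have hA''A : A'' ⊆ A := hS2.1
  have hB''Be : B'' ⊆ B.erase y := hS2.2.1
  have hB''B : B'' ⊆ B := hB''Be.trans (erase_subset y B)
  have hl := hS2.2.2.1
  have hpop := hS2.2.2.2.1
  rcases step_one hS2 hA''ne hB''ne hsA hsB with h1 | ⟨htight, hHρ, -⟩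
  · left; rw [e0]; omega
  set H := (A'' + B'').addStab with hH
  have hSne : (A'' + B'').Nonempty := hA''ne.add hB''ne
  have hper : A'' + B'' + H = A'' + B'' := add_addStab _
  -- `y ∉ B'' + H`: otherwise the drop would be at most `|A \ A''| ≤ t - 1`
  have hyH : y ∉ B'' + H := by
    intro hyH
    have hd := NS_erase_right t A hy
    have hfilt : A.filter (fun a => rep A (B.erase y) (a + y) < t) ⊆ A \ A'' := by
      intro a ha
      rw [mem_filter] at ha
      refine mem_sdiff.2 ⟨ha.1, fun ha'' => ?_⟩
      obtain ⟨b'', hb'', h, hh, rfl⟩ := mem_add.1 hyH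
      have hmem : a + (b'' + h) ∈ A'' + B'' := by
        rw [← hper, ← add_assoc]; exact add_mem_add (add_mem_add ha'' hb'') hh
      have := (hpop _ hmem).trans (rep_mono hA''A hB''Be _)
      exact absurd ha.2 (not_lt.2 this)
    have := card_le_card hfilt
    omega
  -- hence `B''` is saturated in `B` as well
  have hsB' : Sat B B'' (A'' + B'').addStab := by
    intro b hb hbH
    have hby : b ≠ y := fun e => hyH (by rw [← e]; exact hbH)
    exact hsB b (mem_erase.2 ⟨hby, hb⟩) hbH
  have hcA := card_sdiff_add_card_eq_card hA''A
  have hcBe := card_sdiff_add_card_eq_card hB''Be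
  have hcB := card_sdiff_add_card_eq_card hB''B
  by_cases hl2 : (A \ A'').card + ((B.erase y) \ B'').card + 2 ≤ t
  · -- `l ≤ t - 2`: the same witnesses work for `(A, B)`
    right
    refine ⟨A'', B'', hA''A, hB''B, by omega, hpop, fun w hw => ?_⟩
    by_contra hw'
    have h1 := rep_le_card_sdiff_add (A := A) (B := B.erase y) hw'
    have h2 := rep_erase_right (A := A) hy w
    have h3 : rep A B w ≤ rep A (B.erase y) w + 1 := by rw [h2]; split_ifs <;> omega
    omega
  · -- `l = t - 1`: the `t` deleted elements of `(A, B)` give the bound `t(|A|+|B|) - t²`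
    left
    have hlt : (A \ A'').card + (B \ B'').card = t := by omega
    have hp := pairs_outside_ge hA''A hB''B hA''ne hB''ne htight hsA hsB'
    rw [← hH, hlt] at hp
    have hNS := NS_eq_of_threshold (t := t) (A := A) (B := B) (C := A'' + B'')
      (add_subset_add hA''A hB''B)
      (fun w hw => (hpop w hw).trans (rep_mono hA''A hB''B w))
      (fun w _ hw => (rep_le_card_sdiff_add hw).trans hlt.le)
    have hρA : A''.card ≤ (A'' + H).card := card_le_card_add_addStab hSne A''
    have hρB : B''.card ≤ (B'' + H).card := card_le_card_add_addStab hSne B''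
    set ρ := ((A'' + H).card - A''.card) + ((B'' + H).card - B''.card) with hρ
    obtain ⟨d, hd⟩ : ∃ d, H.card = ρ + d := ⟨H.card - ρ, by omega⟩
    rw [hd, Nat.add_sub_cancel_left] at hp
    have hS' : (A'' + B'').card + H.card = A''.card + B''.card + ρ := by omega
    have e3 : A.card + B.card = A''.card + B''.card + t := by omega
    have e1 : t * (A'' + B'').card + t * H.card = t * A''.card + t * B''.card + t * ρ := by
      rw [← mul_add, hS']; ring
    have e2 : t * H.card = t * ρ + t * d := by rw [hd, mul_add]
    rw [hNS, e3, mul_add, mul_add]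
    linarith

/-- **STEP 2**, erasing from `A`. [cite: Grynkiewicz2010, §2 Step 2] -/
theorem step_two_left (ht : 1 ≤ t) (hc : t * t ≤ c) (ih : IH t c A B) (hA : t + 1 ≤ A.card)
    (hB : t + 1 ≤ B.card) {y : G} (hy : y ∈ A) (hdrop : NS t (A.erase y) B + t ≤ NS t A B) :
    Goal t c A B := by
  refine (step_two ht hc ih.symm hB hA hy ?_).symm
  rwa [NS_comm, NS_comm t B A]

/-- STEP 2 via a row: if some `b ∈ B` has at least `t` partners `a ∈ A` with `r(a + b) ≤ t`, then `Goal`.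
[cite: Grynkiewicz2010, §2 Step 2] -/
theorem goal_of_row (ht : 1 ≤ t) (hc : t * t ≤ c) (ih : IH t c A B) (hA : t + 1 ≤ A.card)
    (hB : t + 1 ≤ B.card) {b : G} (hb : b ∈ B) (h : t ≤ (A.filter (fun a => rep A B (a + b) ≤ t)).card) :
    Goal t c A B :=
  step_two ht hc ih hA hB hb (by rw [NS_erase_right' t A hb]; omega)

/-- STEP 2 via a column: if some `a ∈ A` has at least `t` partners `b ∈ B` with `r(a + b) ≤ t`, then `Goal`.
[cite: Grynkiewicz2010, §2 Step 2] -/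
theorem goal_of_col (ht : 1 ≤ t) (hc : t * t ≤ c) (ih : IH t c A B) (hA : t + 1 ≤ A.card)
    (hB : t + 1 ≤ B.card) {a : G} (ha : a ∈ A) (h : t ≤ (B.filter (fun b => rep A B (a + b) ≤ t)).card) :
    Goal t c A B :=
  step_two_left ht hc ih hA hB ha (by rw [NS_erase_left' t B ha]; omega)

/-- The pigeonhole form (unstuff): if for some `a₀ ∈ A`, `b₀ ∈ B` at least `2t − 1` of the sums
`a₀ + b` (`b ∈ B`) and `a + b₀` (`a ∈ A`) have at most `t` representations, then `Goal`.
[cite: Grynkiewicz2010, §2 Step 2] -/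
theorem goal_of_unstuff (ht : 1 ≤ t) (hc : t * t ≤ c) (ih : IH t c A B) (hA : t + 1 ≤ A.card)
    (hB : t + 1 ≤ B.card) {a₀ b₀ : G} (ha₀ : a₀ ∈ A) (hb₀ : b₀ ∈ B)
    (h : 2 * t ≤ (B.filter (fun b => rep A B (a₀ + b) ≤ t)).card +
      (A.filter (fun a => rep A B (a + b₀) ≤ t)).card + 1) : Goal t c A B := by
  by_cases h1 : t ≤ (B.filter (fun b => rep A B (a₀ + b) ≤ t)).card
  · exact goal_of_col ht hc ih hA hB ha₀ h1
  · exact goal_of_row ht hc ih hA hB hb₀ (by omega)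

/-- Translating by a period of `A` does not change `r_{A,B}`. [cite: Grynkiewicz2010, §2 (stab-A-small)] -/
theorem rep_add_of_mem_addStab {h : G} (hh : h ∈ A.addStab) (w : G) : rep A B (w + h) = rep A B w := by
  have hA : A.Nonempty := Nonempty.of_addStab ⟨h, hh⟩
  have e : h +ᵥ A = A := (mem_addStab hA).1 hh
  conv_lhs => rw [← e, rep_comm, rep_vadd_right, rep_comm, add_sub_cancel_right]

/-- **(stab-A-small) of [Gry10] §2.**  If `|stab(A)| ≥ t` then `Goal t c A B`: either every sum is
`t`-popular (structure with `l = 0`), or an unpopular sum `a + b` has `|stab(A)| ≥ t` translates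
`a + h + b` in its column, and STEP 2 applies. [cite: Grynkiewicz2010, §2 Step 2] -/
theorem goal_of_card_addStab_ge (ht : 1 ≤ t) (hc : t * t ≤ c) (ih : IH t c A B) (hA : t + 1 ≤ A.card)
    (hB : t + 1 ≤ B.card) (hstab : t ≤ A.addStab.card) : Goal t c A B := by
  by_cases hall : ∀ w ∈ A + B, t ≤ rep A B w
  · exact Or.inr ⟨A, B, Str.of_popular ht hall⟩
  push Not at hall
  obtain ⟨w, hw, hlt⟩ := hall
  obtain ⟨a, ha, b, hb, rfl⟩ := mem_add.1 hw
  have hsub : a +ᵥ A.addStab ⊆ A.filter (fun x => rep A B (x + b) ≤ t) := by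
    intro x hx
    obtain ⟨h, hh, rfl⟩ := mem_vadd_finset.1 hx
    rw [mem_filter, vadd_eq_add]
    refine ⟨vadd_finset_addStab_subset ha (mem_vadd_finset.2 ⟨h, hh, rfl⟩), ?_⟩
    rw [show a + h + b = (a + b) + h by abel, rep_add_of_mem_addStab hh]
    exact hlt.le
  have hcard : t ≤ (A.filter (fun x => rep A B (x + b) ≤ t)).card :=
    hstab.trans ((card_vadd_finset a A.addStab).symm.le.trans (card_le_card hsub))
  exact goal_of_row ht hc ih hA hB hb hcard

end StepTwo

end Grynkiewicz

end Literature.Combinatorics.Additive
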